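/-
Copyright (c) 2026 the pub-hodgecm-mathlib formalisation cell (harness21).  Prover seat hodgecm-mathlib-LH4-p09 (g8), req620 Track A «(D-RAM) FOUR-FRAME» squad
(heir dealer LH4-plan (g13) WORD #74 (2): (d) lev-trunk assembly — its G2∕G3 two-token cells need the two-token rotation engine typed here).  2026-09-04.
-/
import Summits.HodgeConjecture.HodgeConjecture.Theorems.F0P3cDyRamLabelledKappaStrataPermutation   -- ★ p859787 (LH4-p12 (g7)): one-token engine; brings ★ `…DiagonalKappaPermutation`, ★ p859291 `…LabelledStrataPermutation`
import HarnessLib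

/-!
# (D-RAM) four-frame, STAGE 1b — (T-2tok) ROTATION ENGINE: the TWO-TOKEN label-cut κ-weighted count of a stratum moves with its slot and BOTH labels
# (two-token twin of LH4-p12 (g7)'s ★ p859787), and the G2 ∕ G3 two-token cells from any G1 two-token statement

Helper brick for dealer LH4-plan (g13) WORD #74 (2) ((d) lev-trunk assembly, this seat; the assembly's `hG2 ∕ hG3` cells are rotations of the ★ two-token G1 cells T2b
★ p860000): `Theorems/` only, statement-first, ★-only imports, lane `--supports stmt-HodgeConjecture-24833 --as helper`; it PAYS NO tier-0 row (count-neutral).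

* §1 `image_mapGL_stratum_sep_two` (the two labels ride along: ★ p859291 `latticeInLevel_diagonal_mapGL_perm_iff` twice over ★ `image_mapGL_stratum`) and
  **`finsum_kappaCount_mul_stabiliserWeight_stratum_sep_two_perm`**:
  `Σᶠ_{M ∈ stratum(T,a), L(e₁)M ∧ L(e₂)M} κᵢ·w = Σᶠ_{M ∈ stratum(P⁻¹TP, a∘π⁻¹), L(e₁∘π⁻¹)M ∧ L(e₂∘π⁻¹)M} κ_{πi}·w` (★ `kappaCount_mul_stabiliserWeight_mapGL_perm`).
* §2 the two adapters `…_sep_two_swap01_of` (datum `(β, α; n₂, n₁, n₃)`, labels `(eⱼ1, eⱼ0, eⱼ2)`, slot `swap 0 1 i`) and `…_sep_two_swap02_of` (datum `(α⁻¹, βα⁻¹; n₃, n₂, n₁)` by ★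
  `exists_gl_rescale_swap02` ∕ ★ `stratum_eq_of_coe_eq_smul`, labels `(eⱼ2, eⱼ1, eⱼ0)`, slot `swap 0 2 i`) — verbatim twins of ★ p859787 §2 with a `Hyp ∕ F` carrying two label vectors.
* §3 **`finsum_kappaCount_mul_stabiliserWeight_stratum_G2_sep_two_of_G1`**, **`…_G3_sep_two_of_G1`** — the type-0 glued rotations `(2ρ+s, 2ρ, 2ρ+s)` ∕ `(2ρ+s, 2ρ+s, 2ρ)`.
At the letters of record the swapped labels are again model tokens: `(0 1)` sends `(D₁, D₂)` of `(α, β)` to `(D₁, D₂)` of `(β, α)` on the nose; `(0 2)` sends them to `(0, β−1, α−1)`,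
`(0, (β−1)², (α−1)²)`, which differ from the rescaled datum's `D₁, D₂` by scalar shifts and a unit factor (the assembly handles that step where the reads allow it).

HONEST LABEL: helper organs for the (d) assembly of HYPOTHESES (the four lev trunk letters); STAGE-1b tier-0 rows and the ED. 5∕6 law stubs stay OPEN; HC_CM is proved only
modulo the 7 printed citations (2 remaining named inputs: hLiu418 = `stmt-HodgeConjecture-24832`, h413 = `stmt-HodgeConjecture-24833`) until rung 0 closes.

## References
* [Kottwitz1986BaseChangeUnits] R. E. Kottwitz, *Base change for unit elements of Hecke algebras*, Compositio Math. 60 (1986), §1 pp. 240–241 (lattice counts modulo the torus).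
* [Rogawski1990] J. D. Rogawski, *Automorphic Representations of Unitary Groups in Three Variables*, Ann. of Math. Stud. 123 (1990), §4.9 Prop. 4.9.1 (a) p. 55.
* [LanglandsShelstad1987] R. P. Langlands, D. Shelstad, *On the definition of transfer factors*, Math. Ann. 278 (1987), §3 (κ as a character; its slot moves with the coordinates).
-/

set_option autoImplicit false

noncomputable section

namespace Summit.HodgeConjecture.HodgeConjecture.Cruxes.H413.F0P3cDyRamLabelledKappaTwoTokenRotations

open Matrix
open Literature.NumberTheory.Automorphic Literature.NumberTheory.Automorphic.HermitianLattice
open Literature.NumberTheory.Automorphic.UnitaryLatticeTree Literature.NumberTheory.Automorphic.UnitaryThreeFourFrame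
open Summit.HodgeConjecture.HodgeConjecture.Cruxes.H413.F0P3cDyRamDiagonalTorusDefs
open Summit.HodgeConjecture.HodgeConjecture.Cruxes.H413.F0P3cDyRamDiagonalStrataDefs
open Summit.HodgeConjecture.HodgeConjecture.Cruxes.H413.F0P3cDyRamDiagonalPermutation
open Summit.HodgeConjecture.HodgeConjecture.Cruxes.H413.F0P3cDyRamDiagonalKappaCountDefs
open Summit.HodgeConjecture.HodgeConjecture.Cruxes.H413.F0P3cDyRamDiagonalKappaPermutation
open Summit.HodgeConjecture.HodgeConjecture.Cruxes.H413.F0P3cDyRamFourFrameCensusDefs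
open Summit.HodgeConjecture.HodgeConjecture.Cruxes.H413.F0P3cDyRamLabelledStrataPermutation
open Summit.HodgeConjecture.HodgeConjecture.Cruxes.H413.F0P3cDyRamLabelledKappaStrataPermutation (comp_swap01_symm_eq comp_swap02_symm_eq)
open scoped Valued WithZero Matrix MatrixGroups

/-! ## §1  Two labels ride along a coordinate permutation -/

section Transport

variable {K : Type} [Field K] [Valued K ℤᵐ⁰]

/-- `P · {M ∈ stratum(P⁻¹TP, a∘π⁻¹) : L(e₁∘π⁻¹)M ∧ L(e₂∘π⁻¹)M} = {M ∈ stratum(T, a) : L(e₁)M ∧ L(e₂)M}` (★ `image_mapGL_stratum` + ★ p859291 token transport, twice).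
[cite: Kottwitz1986BaseChangeUnits, §1 pp. 240–241] -/
theorem image_mapGL_stratum_sep_two (σ : K →+* K) (ϖ : K) {π : Equiv.Perm (Fin 3)} (P : GL (Fin 3) K) (hP : (P : Matrix (Fin 3) (Fin 3) K) = π.permMatrix K)
    (T : GL (Fin 3) K) (a : Fin 3 → ℕ) (ℓ₁ ℓ₂ : ℕ) (e₁ e₂ : Fin 3 → K) :
    mapGL P '' {M | M ∈ stratum σ ϖ (P⁻¹ * T * P) (a ∘ ⇑π.symm) ∧
        (LatticeInLevel ϖ ℓ₁ (Matrix.diagonal (e₁ ∘ ⇑π.symm)) M ∧ LatticeInLevel ϖ ℓ₂ (Matrix.diagonal (e₂ ∘ ⇑π.symm)) M)} =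
      {M | M ∈ stratum σ ϖ T a ∧ (LatticeInLevel ϖ ℓ₁ (Matrix.diagonal e₁) M ∧ LatticeInLevel ϖ ℓ₂ (Matrix.diagonal e₂) M)} := by
  have himg := image_mapGL_stratum σ ϖ P hP T a
  ext M'
  constructor
  · rintro ⟨M, ⟨hM, hQ₁, hQ₂⟩, rfl⟩
    have h1 : mapGL P M ∈ stratum σ ϖ T a := by rw [← himg]; exact ⟨M, hM, rfl⟩
    exact ⟨h1, (latticeInLevel_diagonal_mapGL_perm_iff P hP ϖ ℓ₁ e₁ M).2 hQ₁, (latticeInLevel_diagonal_mapGL_perm_iff P hP ϖ ℓ₂ e₂ M).2 hQ₂⟩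
  · rintro ⟨hM', hQ₁', hQ₂'⟩
    have h1 : M' ∈ mapGL P '' stratum σ ϖ (P⁻¹ * T * P) (a ∘ ⇑π.symm) := by rw [himg]; exact hM'
    obtain ⟨M, hM, rfl⟩ := h1
    exact ⟨M, ⟨hM, (latticeInLevel_diagonal_mapGL_perm_iff P hP ϖ ℓ₁ e₁ M).1 hQ₁', (latticeInLevel_diagonal_mapGL_perm_iff P hP ϖ ℓ₂ e₂ M).1 hQ₂'⟩, rfl⟩

/-- **THE TWO-TOKEN LABEL-CUT κ-WEIGHTED COUNT OF A STRATUM MOVES WITH ITS SLOT AND BOTH LABELS** (any `tv`):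
`Σᶠ_{M ∈ stratum(T,a), L(e₁)M ∧ L(e₂)M} κᵢ(M)·w(M) = Σᶠ_{M ∈ stratum(P⁻¹TP, a∘π⁻¹), L(e₁∘π⁻¹)M ∧ L(e₂∘π⁻¹)M} κ_{πi}(M)·w(M)` (§1 + ★ `kappaCount_mul_stabiliserWeight_mapGL_perm`).
[cite: Kottwitz1986BaseChangeUnits, §1 pp. 240–241] [cite: LanglandsShelstad1987, §3] -/
theorem finsum_kappaCount_mul_stabiliserWeight_stratum_sep_two_perm (σ : K →+* K) (ϖ : K) {π : Equiv.Perm (Fin 3)} (P : GL (Fin 3) K)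
    (hP : (P : Matrix (Fin 3) (Fin 3) K) = π.permMatrix K) (T : GL (Fin 3) K) (a : Fin 3 → ℕ) (tv : ℕ) (i : Fin 3) (ℓ₁ ℓ₂ : ℕ) (e₁ e₂ : Fin 3 → K) :
    ∑ᶠ M ∈ {M | M ∈ stratum σ ϖ T a ∧ (LatticeInLevel ϖ ℓ₁ (Matrix.diagonal e₁) M ∧ LatticeInLevel ϖ ℓ₂ (Matrix.diagonal e₂) M)},
        (kappaCount σ ϖ tv i M : ℚ) * stabiliserWeight σ M =
      ∑ᶠ M ∈ {M | M ∈ stratum σ ϖ (P⁻¹ * T * P) (a ∘ ⇑π.symm) ∧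
          (LatticeInLevel ϖ ℓ₁ (Matrix.diagonal (e₁ ∘ ⇑π.symm)) M ∧ LatticeInLevel ϖ ℓ₂ (Matrix.diagonal (e₂ ∘ ⇑π.symm)) M)},
        (kappaCount σ ϖ tv (π i) M : ℚ) * stabiliserWeight σ M := by
  rw [← image_mapGL_stratum_sep_two σ ϖ P hP T a ℓ₁ ℓ₂ e₁ e₂, finsum_mem_image (mapGL_injective P).injOn]
  exact finsum_mem_congr rfl fun M _ => kappaCount_mul_stabiliserWeight_mapGL_perm σ ϖ P hP tv i M

end Transport

/-! ## §2  The two adapters over an element datum -/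

section Adapters

variable {K : Type} [Field K] [Valued K ℤᵐ⁰] {σ : K →+* K} {ϖ : K} {α β : K} {N₀ n₁ n₂ n₃ : ℕ} {T : GL (Fin 3) K}

/-- **TWO-TOKEN κ-ADAPTER `(a,b,c) ↦ (b,a,c)`** (swap `(0 1)`: datum `(β, α; n₂, n₁, n₃)`, labels `(eⱼ1, eⱼ0, eⱼ2)`, slot `swap 0 1 i`).
[cite: Kottwitz1986BaseChangeUnits, §1 pp. 240–241] [cite: Rogawski1990, §4.9 Prop. 4.9.1 (a) p. 55] -/
theorem finsum_kappaCount_mul_stabiliserWeight_stratum_sep_two_swap01_of (hE : IsElementDatum σ ϖ N₀ α β n₁ n₂ n₃)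
    (hT : (T : Matrix (Fin 3) (Fin 3) K) = Matrix.diagonal ![α, β, 1]) (tv a b c ℓ₁ ℓ₂ : ℕ)
    (Hyp : K → K → ℕ → ℕ → ℕ → (Fin 3 → K) → (Fin 3 → K) → Prop) (F : K → K → ℕ → ℕ → ℕ → (Fin 3 → K) → (Fin 3 → K) → Fin 3 → ℚ)
    (hG1 : ∀ {α' β' : K} {n₁' n₂' n₃' : ℕ} (T' : GL (Fin 3) K) (e₁' e₂' : Fin 3 → K), IsElementDatum σ ϖ N₀ α' β' n₁' n₂' n₃' →
      (T' : Matrix (Fin 3) (Fin 3) K) = Matrix.diagonal ![α', β', 1] → Hyp α' β' n₁' n₂' n₃' e₁' e₂' →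
        ∀ i : Fin 3, ∑ᶠ M ∈ {M | M ∈ stratum σ ϖ T' ![a, b, c] ∧
            (LatticeInLevel ϖ ℓ₁ (Matrix.diagonal e₁') M ∧ LatticeInLevel ϖ ℓ₂ (Matrix.diagonal e₂') M)},
          (kappaCount σ ϖ tv i M : ℚ) * stabiliserWeight σ M = F α' β' n₁' n₂' n₃' e₁' e₂' i)
    (e₁ e₂ : Fin 3 → K) (hHyp : Hyp β α n₂ n₁ n₃ ![e₁ 1, e₁ 0, e₁ 2] ![e₂ 1, e₂ 0, e₂ 2]) (i : Fin 3) :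
    ∑ᶠ M ∈ {M | M ∈ stratum σ ϖ T ![b, a, c] ∧ (LatticeInLevel ϖ ℓ₁ (Matrix.diagonal e₁) M ∧ LatticeInLevel ϖ ℓ₂ (Matrix.diagonal e₂) M)},
        (kappaCount σ ϖ tv i M : ℚ) * stabiliserWeight σ M =
      F β α n₂ n₁ n₃ ![e₁ 1, e₁ 0, e₁ 2] ![e₂ 1, e₂ 0, e₂ 2] (Equiv.swap (0 : Fin 3) 1 i) := by
  obtain ⟨P, hP⟩ := exists_gl_coe_eq_permMatrix (K := K) (Equiv.swap (0 : Fin 3) 1)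
  rw [finsum_kappaCount_mul_stabiliserWeight_stratum_sep_two_perm σ ϖ P hP T _ tv i ℓ₁ ℓ₂ e₁ e₂]
  have ha : (![b, a, c] : Fin 3 → ℕ) ∘ ⇑(Equiv.swap (0 : Fin 3) 1).symm = ![a, b, c] := by
    ext i; fin_cases i <;> rfl
  have hd : (![α, β, 1] : Fin 3 → K) ∘ ⇑(Equiv.swap (0 : Fin 3) 1).symm = ![β, α, 1] := by
    ext i; fin_cases i <;> rfl
  rw [ha, comp_swap01_symm_eq, comp_swap01_symm_eq]
  exact hG1 _ _ _ (isElementDatum_swap hE) (by rw [coe_conj_eq_diagonal P hP T hT, hd]) hHyp _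

/-- **TWO-TOKEN κ-ADAPTER `(a,b,c) ↦ (c,b,a)`** (swap `(0 2)` + unit rescaling `α⁻¹`: datum `(α⁻¹, βα⁻¹; n₃, n₂, n₁)`, labels `(eⱼ2, eⱼ1, eⱼ0)`, slot `swap 0 2 i`).
[cite: Kottwitz1986BaseChangeUnits, §1 pp. 240–241] [cite: Rogawski1990, §4.9 Prop. 4.9.1 (a) p. 55] -/
theorem finsum_kappaCount_mul_stabiliserWeight_stratum_sep_two_swap02_of (hvσ : ∀ x, Valued.v (σ x) = Valued.v x)
    (hE : IsElementDatum σ ϖ N₀ α β n₁ n₂ n₃) (hT : (T : Matrix (Fin 3) (Fin 3) K) = Matrix.diagonal ![α, β, 1]) (tv a b c ℓ₁ ℓ₂ : ℕ)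
    (Hyp : K → K → ℕ → ℕ → ℕ → (Fin 3 → K) → (Fin 3 → K) → Prop) (F : K → K → ℕ → ℕ → ℕ → (Fin 3 → K) → (Fin 3 → K) → Fin 3 → ℚ)
    (hG1 : ∀ {α' β' : K} {n₁' n₂' n₃' : ℕ} (T' : GL (Fin 3) K) (e₁' e₂' : Fin 3 → K), IsElementDatum σ ϖ N₀ α' β' n₁' n₂' n₃' →
      (T' : Matrix (Fin 3) (Fin 3) K) = Matrix.diagonal ![α', β', 1] → Hyp α' β' n₁' n₂' n₃' e₁' e₂' →
        ∀ i : Fin 3, ∑ᶠ M ∈ {M | M ∈ stratum σ ϖ T' ![a, b, c] ∧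
            (LatticeInLevel ϖ ℓ₁ (Matrix.diagonal e₁') M ∧ LatticeInLevel ϖ ℓ₂ (Matrix.diagonal e₂') M)},
          (kappaCount σ ϖ tv i M : ℚ) * stabiliserWeight σ M = F α' β' n₁' n₂' n₃' e₁' e₂' i)
    (e₁ e₂ : Fin 3 → K) (hHyp : Hyp α⁻¹ (β * α⁻¹) n₃ n₂ n₁ ![e₁ 2, e₁ 1, e₁ 0] ![e₂ 2, e₂ 1, e₂ 0]) (i : Fin 3) :
    ∑ᶠ M ∈ {M | M ∈ stratum σ ϖ T ![c, b, a] ∧ (LatticeInLevel ϖ ℓ₁ (Matrix.diagonal e₁) M ∧ LatticeInLevel ϖ ℓ₂ (Matrix.diagonal e₂) M)},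
        (kappaCount σ ϖ tv i M : ℚ) * stabiliserWeight σ M =
      F α⁻¹ (β * α⁻¹) n₃ n₂ n₁ ![e₁ 2, e₁ 1, e₁ 0] ![e₂ 2, e₂ 1, e₂ 0] (Equiv.swap (0 : Fin 3) 2 i) := by
  have hα : α * σ α = 1 := hE.1
  have hvα : Valued.v α = 1 := by
    have h : Valued.v α * Valued.v α = 1 := by nth_rw 2 [← hvσ α]; rw [← map_mul, hα, map_one]
    rw [← pow_two] at h
    exact ((pow_eq_one_iff).1 h).resolve_right two_ne_zero
  obtain ⟨P, hP⟩ := exists_gl_coe_eq_permMatrix (K := K) (Equiv.swap (0 : Fin 3) 2)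
  rw [finsum_kappaCount_mul_stabiliserWeight_stratum_sep_two_perm σ ϖ P hP T _ tv i ℓ₁ ℓ₂ e₁ e₂]
  have ha : (![c, b, a] : Fin 3 → ℕ) ∘ ⇑(Equiv.swap (0 : Fin 3) 2).symm = ![a, b, c] := by
    ext i; fin_cases i <;> rfl
  rw [ha, comp_swap02_symm_eq, comp_swap02_symm_eq]
  obtain ⟨T'', hT'', hTT⟩ := exists_gl_rescale_swap02 hE hT P hP
  rw [← stratum_eq_of_coe_eq_smul σ ϖ (by rw [map_inv₀, hvα, inv_one]) hTT]
  exact hG1 _ _ _ (isElementDatum_rescale hvσ hE) hT'' hHyp _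

end Adapters

/-! ## §3  The type-0 glued rotations with two labels -/

section Rotations

variable {K : Type} [Field K] [Valued K ℤᵐ⁰] {σ : K →+* K} {ϖ : K} {α β : K} {N₀ n₁ n₂ n₃ : ℕ} {T : GL (Fin 3) K}

/-- **TWO-TOKEN κ-G2 `(2ρ+s, 2ρ, 2ρ+s)` FROM ANY TWO-TOKEN κ-G1 STATEMENT** (type 0; swap `(0 1)`). [cite: Kottwitz1986BaseChangeUnits, §1 pp. 240–241]
[cite: Rogawski1990, §4.9 Prop. 4.9.1 (a) p. 55] [cite: LanglandsShelstad1987, §3] -/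
theorem finsum_kappaCount_mul_stabiliserWeight_stratum_G2_sep_two_of_G1 (hE : IsElementDatum σ ϖ N₀ α β n₁ n₂ n₃)
    (hT : (T : Matrix (Fin 3) (Fin 3) K) = Matrix.diagonal ![α, β, 1]) (ρ s ℓ₁ ℓ₂ : ℕ)
    (Hyp : K → K → ℕ → ℕ → ℕ → (Fin 3 → K) → (Fin 3 → K) → Prop) (F : K → K → ℕ → ℕ → ℕ → (Fin 3 → K) → (Fin 3 → K) → Fin 3 → ℚ)
    (hG1 : ∀ {α' β' : K} {n₁' n₂' n₃' : ℕ} (T' : GL (Fin 3) K) (e₁' e₂' : Fin 3 → K), IsElementDatum σ ϖ N₀ α' β' n₁' n₂' n₃' →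
      (T' : Matrix (Fin 3) (Fin 3) K) = Matrix.diagonal ![α', β', 1] → Hyp α' β' n₁' n₂' n₃' e₁' e₂' →
        ∀ i : Fin 3, ∑ᶠ M ∈ {M | M ∈ stratum σ ϖ T' ![2 * ρ, 2 * ρ + s, 2 * ρ + s] ∧
            (LatticeInLevel ϖ ℓ₁ (Matrix.diagonal e₁') M ∧ LatticeInLevel ϖ ℓ₂ (Matrix.diagonal e₂') M)},
          (kappaCount σ ϖ 0 i M : ℚ) * stabiliserWeight σ M = F α' β' n₁' n₂' n₃' e₁' e₂' i)
    (e₁ e₂ : Fin 3 → K) (hHyp : Hyp β α n₂ n₁ n₃ ![e₁ 1, e₁ 0, e₁ 2] ![e₂ 1, e₂ 0, e₂ 2]) (i : Fin 3) :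
    ∑ᶠ M ∈ {M | M ∈ stratum σ ϖ T ![2 * ρ + s, 2 * ρ, 2 * ρ + s] ∧ (LatticeInLevel ϖ ℓ₁ (Matrix.diagonal e₁) M ∧ LatticeInLevel ϖ ℓ₂ (Matrix.diagonal e₂) M)},
        (kappaCount σ ϖ 0 i M : ℚ) * stabiliserWeight σ M =
      F β α n₂ n₁ n₃ ![e₁ 1, e₁ 0, e₁ 2] ![e₂ 1, e₂ 0, e₂ 2] (Equiv.swap (0 : Fin 3) 1 i) :=
  finsum_kappaCount_mul_stabiliserWeight_stratum_sep_two_swap01_of hE hT 0 (2 * ρ) (2 * ρ + s) (2 * ρ + s) ℓ₁ ℓ₂ Hyp F hG1 e₁ e₂ hHyp i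

/-- **TWO-TOKEN κ-G3 `(2ρ+s, 2ρ+s, 2ρ)` FROM ANY TWO-TOKEN κ-G1 STATEMENT** (type 0; swap `(0 2)` + rescaling). [cite: Kottwitz1986BaseChangeUnits, §1 pp. 240–241]
[cite: Rogawski1990, §4.9 Prop. 4.9.1 (a) p. 55] [cite: LanglandsShelstad1987, §3] -/
theorem finsum_kappaCount_mul_stabiliserWeight_stratum_G3_sep_two_of_G1 (hvσ : ∀ x, Valued.v (σ x) = Valued.v x)
    (hE : IsElementDatum σ ϖ N₀ α β n₁ n₂ n₃) (hT : (T : Matrix (Fin 3) (Fin 3) K) = Matrix.diagonal ![α, β, 1]) (ρ s ℓ₁ ℓ₂ : ℕ)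
    (Hyp : K → K → ℕ → ℕ → ℕ → (Fin 3 → K) → (Fin 3 → K) → Prop) (F : K → K → ℕ → ℕ → ℕ → (Fin 3 → K) → (Fin 3 → K) → Fin 3 → ℚ)
    (hG1 : ∀ {α' β' : K} {n₁' n₂' n₃' : ℕ} (T' : GL (Fin 3) K) (e₁' e₂' : Fin 3 → K), IsElementDatum σ ϖ N₀ α' β' n₁' n₂' n₃' →
      (T' : Matrix (Fin 3) (Fin 3) K) = Matrix.diagonal ![α', β', 1] → Hyp α' β' n₁' n₂' n₃' e₁' e₂' →
        ∀ i : Fin 3, ∑ᶠ M ∈ {M | M ∈ stratum σ ϖ T' ![2 * ρ, 2 * ρ + s, 2 * ρ + s] ∧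
            (LatticeInLevel ϖ ℓ₁ (Matrix.diagonal e₁') M ∧ LatticeInLevel ϖ ℓ₂ (Matrix.diagonal e₂') M)},
          (kappaCount σ ϖ 0 i M : ℚ) * stabiliserWeight σ M = F α' β' n₁' n₂' n₃' e₁' e₂' i)
    (e₁ e₂ : Fin 3 → K) (hHyp : Hyp α⁻¹ (β * α⁻¹) n₃ n₂ n₁ ![e₁ 2, e₁ 1, e₁ 0] ![e₂ 2, e₂ 1, e₂ 0]) (i : Fin 3) :
    ∑ᶠ M ∈ {M | M ∈ stratum σ ϖ T ![2 * ρ + s, 2 * ρ + s, 2 * ρ] ∧ (LatticeInLevel ϖ ℓ₁ (Matrix.diagonal e₁) M ∧ LatticeInLevel ϖ ℓ₂ (Matrix.diagonal e₂) M)},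
        (kappaCount σ ϖ 0 i M : ℚ) * stabiliserWeight σ M =
      F α⁻¹ (β * α⁻¹) n₃ n₂ n₁ ![e₁ 2, e₁ 1, e₁ 0] ![e₂ 2, e₂ 1, e₂ 0] (Equiv.swap (0 : Fin 3) 2 i) :=
  finsum_kappaCount_mul_stabiliserWeight_stratum_sep_two_swap02_of hvσ hE hT 0 (2 * ρ) (2 * ρ + s) (2 * ρ + s) ℓ₁ ℓ₂ Hyp F hG1 e₁ e₂ hHyp i

end Rotations

end Summit.HodgeConjecture.HodgeConjecture.Cruxes.H413.F0P3cDyRamLabelledKappaTwoTokenRotations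

end
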